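import Mathlib.CategoryTheory.Functor.Basic
import Mathlib.Tactic.Ring
import Literature.IUT.HodgeTheaters.Conventions
import Literature.IUT.LogThetaLattice.FrobeniusPicture

/-!
# [IUTchII] Corollaries 4.10, 4.11: `Θ^{×μ}`- and `Θ^{×μ}_{gau}`-links, coricity, Frobenius- and
# étale-pictures of `Θ^{±ell}NF`-Hodge theaters

S. Mochizuki, *Inter-universal Teichmüller theory II*, §4, Corollary 4.10 (i)–(vi) (kurims
Dec-2020 manuscript pp. 158–161; (i) = PRIMS **57** pp. 384–385), Remarks 4.10.1–4.10.3
(pp. 161–163), Corollary 4.11 (i)–(iii) (pp. 163–164), Remark 4.11.1 (pp. 164–165)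
[cite: Mochizuki2012, Cor 4.10 p.158]. Claim key DISPUTED (D-0012): definitions and Prop-valued
statements only; nothing here asserts a disputed claim or takes a side.

**What is printed.** (4.10 (iii), p. 159–160) For `Θ^{±ell}NF`-Hodge theaters `†HT`, `‡HT`,
write `‡F^{⊩▶×μ}_△`, `†F^{⊩▶×μ}_env`, `†F^{⊩▶×μ}_gau` for the `F^{⊩▶×μ}`-prime-strips associated
(Def 4.9 (vi), (viii)) to the `F^⊩`-prime-strips `‡F^⊩_△`, `†F^⊩_env`, `†F^⊩_gau`; "the
functoriality of this algorithm induces maps `Isom_{F^⊩}(†F^⊩_env, ‡F^⊩_△) →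
Isom_{F^{⊩▶×μ}}(†F^{⊩▶×μ}_env, ‡F^{⊩▶×μ}_△)` … from [nonempty!] sets of isomorphisms"; "We shall
refer to the full poly-isomorphism `†F^{⊩▶×μ}_env ⥲ ‡F^{⊩▶×μ}_△` as the `Θ^{×μ}`-link … and to
the full poly-isomorphism `†F^{⊩▶×μ}_gau ⥲ ‡F^{⊩▶×μ}_△` as the `Θ^{×μ}_{gau}`-link".
(iv) the composite poly-isomorphism `†F^{⊢×μ}_△ ⥲ ‡F^{⊢×μ}_△` "coincides with the full
poly-isomorphism" — "`(−)F^{⊢×μ}_△` is an invariant of both the `Θ^{×μ}`- and `Θ^{×μ}_{gau}`-links";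
it induces the full poly-isomorphism `†D^⊢_△ ⥲ ‡D^⊢_△`, "the `D`-`Θ^{±ell}NF`-link".
(vi) For a `ℤ`-indexed collection of distinct Hodge theaters one obtains infinite chains; the
oriented graph `⃗Γ` "`… → • → • → • → …`" "admits a natural action by `ℤ` — i.e., a translation
symmetry — but it does not admit arbitrary permutation symmetries. For instance, `⃗Γ` does not
admit an automorphism that switches two adjacent vertices, but leaves the remaining vertices
fixed". (4.11 (i)) the chain of `D`-`Θ^{±ell}NF`-links induces "a chain of full poly-isomorphisms
`… ⥲ ⁿD^⊢_△ ⥲ ⁽ⁿ⁺¹⁾D^⊢_△ ⥲ …`", i.e. `(−)D^⊢_△` is "a constant invariant … a mono-analytic core";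
(ii) the étale-picture "satisfies the important property of admitting arbitrary permutation
symmetries among the spokes"; (iii) compatibility with [IUTchI] Cors 4.12, 6.10. Remark 4.11.1:
the `Θ^{×μ}_{gau}`-link is "roughly" `q ↦ q^{(1², …, (l⋇)²)}`; Remark 4.10.3 (iii): restricted to
the label `j = 1`, `q ↦ q^{j²}` "may be naturally identified with the identity".

**Dictionary (dedup rulings C9 D1/D2 of plan/L6/ASSIGNMENTS.md applied).** Poly-isomorphisms are
abc-iut-L5-t1's `Literature.IUT.HodgeTheaters.PolyIso` (`PolyIso.full`, `PolyIso.comp`, [IUTchI]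
§0, `Conventions.lean`); this file only adds the conjugation/functor-image operations it needs
(`polyIsoConj`, `polyIsoMap` — to be swapped for abc-iut-L6-t3's `PolyIso.map` /
`comp_full_of_nonempty` of the supplement `HodgeTheaters/PolyIsoFunctoriality.lean` once that is
built; TODO-merge:L6-t3). The oriented graph `⃗Γ` of Cor 4.10 (vi) is the full subdigraph on the
spokes of abc-iut-L6-t3's `Literature.IUT.LogThetaLattice.frobeniusPicture` (the [IUTchIII] Prop 1.2
(x) version, which adds the coric vertex `◦`; every automorphism fixes `◦`, `aut_core`, so the two
automorphism groups coincide), and the étale-picture of Cor 4.11 (ii) is its `etalePicture ℤ`; the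
graph-theoretic sentences of Cor 4.10 (vi) / 4.11 (ii) are DERIVED from `aut_eq_translate`,
`no_adjacent_swap`, `etalePicture.spokePerm`/`exists_swap`. Prime-strip categories and the functors
"`F^⊩ ↦ F^{⊩▶×μ} ↦ F^{⊢×μ} ↦ D^⊢`" (Def 4.9 (vi)–(viii); [IUTchI] Def 5.2, Rem 5.2.1 (i)) are an
INTERFACE over four category PARAMETERS (`ThetaLinkSetting`; v2: no bundling, no instance attributes,
independent object/hom universes — review q9904249 item 4).
-- TODO-merge: abc-iut-L5-t4 ([IUTchI] Def 5.2 prime-strips), abc-iut-L6-t3 (`StripCategories`), this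
-- seat's `KummerPrimeStrips` (Def 4.9 (ii)–(viii)).

**Deliberately NOT here (recorded by locator only; review q9904249 item 2).** Cor 4.10 (v) p. 160–161
(coric global realified Frobenioids: the full poly-isomorphism `†D^⊢_△ ⥲ ‡D^⊢_△` induces an
isomorphism `(D^⊩(†D^⊢_△), Prime ⥲ V, {†ρ_{D^⊩,v}}) ⥲ (D^⊩(‡D^⊢_△), …)` compatible with the `ℝ_{>0}`-orbits
of `(†C^⊩_△, …) ⥲ (D^⊩(†D^⊢_△), …)` from Cor 4.6 (ii)) and Cor 4.11 (iii) p. 164 (compatibility with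
[IUTchI] Cors 4.12, 6.10 via `(−)D^⊢_△ ⥲ (−)D^⊢_>`) have no statable kernel until the objects `D^⊩(−)`,
`C^⊩_△` (this seat's `GlobalGaussianFrobenioids`) and the [IUTchI] étale-pictures (abc-iut-L5-t3/t4)
are real; they are not given junk Prop slots. Remarks 4.10.1–4.10.3 (i),(ii): `ExpositoryRemarks`.

**Proved here (bookkeeping only).** `polyIsoConj` of a full poly-isomorphism is full
(`polyIsoConj_full` — the shape of 4.10 (iv)/4.11 (i)), `PolyIso.comp` of full poly-isomorphisms
through an isomorphic object is full (`full_comp_full`), the reduction of the coricity statement of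
4.10 (iv) to iso-surjectivity of `F^{⊩▶×μ} ↦ F^{⊢×μ}`, and the exponent bookkeeping of Remarks
4.10.3 (iii) / 4.11.1.
-/

namespace Literature.IUT.HodgeArakelov

open CategoryTheory
open Literature.IUT.HodgeTheaters (PolyIso)
open Literature.IUT.LogThetaLattice

universe v u v₁ v₂ v₃ v₄ u₁ u₂ u₃ u₄

/-! ### 1. Two operations on poly-isomorphisms (over [IUTchI] §0 as typed by abc-iut-L5-t1) -/

section Poly

variable {C : Type u} [Category.{v} C]

/-- Composite of a poly-isomorphism with isomorphisms on both sides ("by composing these natural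
isomorphisms with the poly-isomorphisms induced … by the `Θ^{×μ}`- and `Θ^{×μ}_{gau}`-links",
[IUTchII] Cor 4.10 (iv) p. 160). [cite: Mochizuki2012, Cor 4.10 (iv) p.160] -/
def polyIsoConj {X X' Y Y' : C} (α : X' ≅ X) (P : PolyIso X Y) (β : Y ≅ Y') : PolyIso X' Y' :=
  {φ | ∃ ψ ∈ P, φ = α ≪≫ ψ ≪≫ β}

/-- **Shape of Cor 4.10 (iv) / Cor 4.11 (i).** Conjugating the FULL poly-isomorphism by
isomorphisms yields the FULL poly-isomorphism ("coincides with the full poly-isomorphism", p. 160;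
"`(−)D^⊢_△` forms a constant invariant", p. 164). [cite: Mochizuki2012, Cor 4.10 (iv) p.160] -/
theorem polyIsoConj_full {X X' Y Y' : C} (α : X' ≅ X) (β : Y ≅ Y') :
    polyIsoConj α (PolyIso.full X Y) β = PolyIso.full X' Y' := by
  ext φ
  simp only [polyIsoConj, PolyIso.full, Set.mem_univ, true_and, Set.mem_setOf_eq, iff_true]
  refine ⟨α.symm ≪≫ φ ≪≫ β.symm, ?_⟩
  rw [Iso.trans_assoc, Iso.trans_assoc, Iso.symm_self_id, Iso.trans_refl, ← Iso.trans_assoc,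
    Iso.self_symm_id, Iso.refl_trans]

/-- A composite (`PolyIso.comp` of abc-iut-L5-t1) of full poly-isomorphisms through an object
ISOMORPHIC to the source is full ("a chain of full poly-isomorphisms … a constant invariant",
Cor 4.11 (i) p. 164). [cite: Mochizuki2012, Cor 4.11 (i) p.164] -/
theorem full_comp_full {X Y Z : C} (e : X ≅ Y) :
    PolyIso.comp (PolyIso.full X Y) (PolyIso.full Y Z) = PolyIso.full X Z := by
  ext φ
  simp only [PolyIso.comp, PolyIso.full, Set.mem_image2, Set.mem_univ, true_and, iff_true]
  exact ⟨e, e.symm ≪≫ φ, by rw [← Iso.trans_assoc, Iso.self_symm_id, Iso.refl_trans]⟩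

/-- The image of a poly-isomorphism under a functor ("the functoriality of this algorithm induces
maps `Isom_{F^⊩}(…) → Isom_{F^{⊩▶×μ}}(…)`", Cor 4.10 (iii) p. 159). [cite: Mochizuki2012, Cor 4.10 (iii) p.159] -/
def polyIsoMap {D : Type*} [Category D] (Φ : C ⥤ D) {X Y : C} (P : PolyIso X Y) :
    PolyIso (Φ.obj X) (Φ.obj Y) :=
  {φ | ∃ ψ ∈ P, φ = Φ.mapIso ψ}

/-- If `Isom(X, Y)` is nonempty then so is its image ("from [nonempty!] sets of isomorphisms … to
[nonempty!] sets of isomorphisms", Cor 4.10 (iii) p. 160). [cite: Mochizuki2012, Cor 4.10 (iii) p.160] -/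
theorem polyIsoMap_full_nonempty {D : Type*} [Category D] (Φ : C ⥤ D) {X Y : C}
    (h : Nonempty (X ≅ Y)) : (polyIsoMap Φ (PolyIso.full X Y)).Nonempty :=
  ⟨Φ.mapIso h.some, h.some, Set.mem_univ _, rfl⟩

end Poly

/-! ### 2. Corollary 4.10 (i)–(v) over an interface of bundled categories -/

/-- INTERFACE for Corollary 4.10 (pp. 158–161): over the categories `FV`, `FVM`, `FUM`, `DM` of
`F^⊩`-, `F^{⊩▶×μ}`-, `F^{⊢×μ}`- and `D^⊢`-prime-strips ([IUTchI] Def 5.2 (iv), Def 4.1 (iii); [IUTchII]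
Def 4.9 (vii), (viii)) — type PARAMETERS with their own object/hom universes — the "functorial
algorithms" between them (Def 4.9 (vi): `F^⊩ ↦ F^{⊩▶×μ}`, `F^{⊩▶×μ} ↦ F^{⊢×μ}`; [IUTchI] Rem 5.2.1 (i):
`F^{⊢×μ} ↦ D^⊢`). -- TODO-merge: abc-iut-L5-t4 ([IUTchI] Def 5.2), abc-iut-L6-t3
-- (`StripCategories.StripCat`), this seat's `KummerPrimeStrips`. [cite: Mochizuki2012, Cor 4.10 p.158] -/
structure ThetaLinkSetting (FV : Type u₁) [Category.{v₁} FV] (FVM : Type u₂) [Category.{v₂} FVM]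
    (FUM : Type u₃) [Category.{v₃} FUM] (DM : Type u₄) [Category.{v₄} DM] where
  /-- Def 4.9 (vi),(viii): `F^⊩ ↦ F^{⊩▶×μ}` -/
  toVdashMu : FV ⥤ FVM
  /-- Def 4.9 (vi),(vii): `F^{⊩▶×μ} ↦ F^{⊢×μ}` (pass to isometries and quotients by torsion) -/
  toUnitMu : FVM ⥤ FUM
  /-- [IUTchI] Rem 5.2.1 (i): the associated `D^⊢`-prime-strip -/
  toDMono : FUM ⥤ DM

section Links

variable {FV : Type u₁} [Category.{v₁} FV] {FVM : Type u₂} [Category.{v₂} FVM]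
  {FUM : Type u₃} [Category.{v₃} FUM] {DM : Type u₄} [Category.{v₄} DM]

/-- INTERFACE: the prime-strips Corollary 4.10 (i), (ii) extracts from ONE `Θ^{±ell}NF`-Hodge theater
`†HT` (p. 158–159): `†F^⊩_△` (from `Ψ_cns(†F_≻)_0` identified with `Ψ_cns(†F_≻)_{⟨F_l^⋇⟩}` via Cor 4.6
(iii) — the assignment "`0, ≻ ↦ >`"), `†F^⊩_mod`, `†F^⊩_env`, `†F^⊩_tht`, `†F^⊩_gau`, with the printed
"natural identification isomorphisms" `†F^⊩_△ ⥲ †F^⊩_mod`, `†F^⊩_env ⥲ †F^⊩_tht`, the "evaluation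
isomorphism" `†F^⊩_env ⥲ †F^⊩_gau` (Cor 4.6 (iv), (v)), and (iv) the "natural isomorphisms
`†F^{⊢×μ}_△ ⥲ †F^{⊢×μ}_env ⥲ †F^{⊢×μ}_gau`" given by "the definition of the unit portion of the theta and
Gaussian monoids". -- TODO-merge: abc-iut-L5-t4 ([IUTchI] Def 6.13, Def 3.6 (c)); Cor 4.6 is in this
-- seat's `GlobalGaussianFrobenioids`. [cite: Mochizuki2012, Cor 4.10 (i) p.158] -/
structure HodgeTheaterStrips (S : ThetaLinkSetting FV FVM FUM DM) where
  /-- `†F^⊩_△` (Cor 4.10 (i) p. 158; PRIMS pp. 384–385) -/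
  delta : FV
  /-- `†F^⊩_mod` ([IUTchI] Def 3.6 (c)) -/
  fmod : FV
  /-- `†F^⊩_env` (Cor 4.10 (ii) p. 159) -/
  env : FV
  /-- `†F^⊩_tht` ([IUTchI] Def 3.6 (c)) -/
  tht : FV
  /-- `†F^⊩_gau` (Cor 4.10 (ii) p. 159) -/
  gau : FV
  /-- (i) "natural identification isomorphism of `F^⊩`-prime-strips `†F^⊩_△ ⥲ †F^⊩_mod`" -/
  deltaIsoMod : delta ≅ fmod
  /-- (ii) "natural identification isomorphism … `†F^⊩_env ⥲ †F^⊩_tht`" -/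
  envIsoTht : env ≅ tht
  /-- (ii) "an evaluation isomorphism `†F^⊩_env ⥲ †F^⊩_gau` of `F^⊩`-prime-strips" -/
  evalIso : env ≅ gau
  /-- (iv) "natural isomorphisms `†F^{⊢×μ}_△ ⥲ †F^{⊢×μ}_env`" (unit portions coincide) -/
  unitDeltaIsoEnv : S.toUnitMu.obj (S.toVdashMu.obj delta) ≅ S.toUnitMu.obj (S.toVdashMu.obj env)
  /-- (iv) "`†F^{⊢×μ}_env ⥲ †F^{⊢×μ}_gau`" -/
  unitEnvIsoGau : S.toUnitMu.obj (S.toVdashMu.obj env) ≅ S.toUnitMu.obj (S.toVdashMu.obj gau)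

namespace HodgeTheaterStrips

variable {S : ThetaLinkSetting FV FVM FUM DM} (dag ddag : HodgeTheaterStrips S)

/-- The **`Θ^{×μ}`-link** `†HT ⟶ ‡HT`: "the full poly-isomorphism `†F^{⊩▶×μ}_env ⥲ ‡F^{⊩▶×μ}_△`"
([IUTchII] Cor 4.10 (iii) p. 160). [cite: Mochizuki2012, Cor 4.10 (iii) p.160] -/
def thetaTimesMuLink : PolyIso (S.toVdashMu.obj dag.env) (S.toVdashMu.obj ddag.delta) :=
  PolyIso.full _ _

/-- The **`Θ^{×μ}_{gau}`-link** `†HT ⟶ ‡HT`: "the full poly-isomorphism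
`†F^{⊩▶×μ}_gau ⥲ ‡F^{⊩▶×μ}_△`" ([IUTchII] Cor 4.10 (iii) p. 160). [cite: Mochizuki2012, Cor 4.10 (iii) p.160] -/
def thetaTimesMuGauLink : PolyIso (S.toVdashMu.obj dag.gau) (S.toVdashMu.obj ddag.delta) :=
  PolyIso.full _ _

/-- Cor 4.10 (iii) p. 160: "the second map may be regarded as being obtained from the first map
via composition … with the evaluation isomorphism `†F^⊩_env ⥲ †F^⊩_gau`": precomposing the
`Θ^{×μ}`-link with (the image of) the inverse evaluation isomorphism gives the `Θ^{×μ}_{gau}`-link.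
[cite: Mochizuki2012, Cor 4.10 (iii) p.160] -/
theorem thetaTimesMuGauLink_eq_conj :
    dag.thetaTimesMuGauLink ddag =
      polyIsoConj (S.toVdashMu.mapIso dag.evalIso.symm) (dag.thetaTimesMuLink ddag) (Iso.refl _) := by
  unfold thetaTimesMuGauLink thetaTimesMuLink
  rw [polyIsoConj_full]

/-- The poly-isomorphism `†F^{⊢×μ}_△ ⥲ ‡F^{⊢×μ}_△` of Cor 4.10 (iv) p. 160 obtained through the
`Θ^{×μ}`-LINK: "by composing these natural isomorphisms [`†F^{⊢×μ}_△ ⥲ †F^{⊢×μ}_env`] with the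
poly-isomorphisms induced on the respective `F^{⊢×μ}`-prime-strips by the `Θ^{×μ}`-… link[s]".
[cite: Mochizuki2012, Cor 4.10 (iv) p.160] -/
def unitMuPolyIso : PolyIso (S.toUnitMu.obj (S.toVdashMu.obj dag.delta))
    (S.toUnitMu.obj (S.toVdashMu.obj ddag.delta)) :=
  polyIsoConj dag.unitDeltaIsoEnv (polyIsoMap S.toUnitMu (dag.thetaTimesMuLink ddag)) (Iso.refl _)

/-- The poly-isomorphism `†F^{⊢×μ}_△ ⥲ ‡F^{⊢×μ}_△` of Cor 4.10 (iv) p. 160 obtained through the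
`Θ^{×μ}_{gau}`-LINK: compose `†F^{⊢×μ}_△ ⥲ †F^{⊢×μ}_env ⥲ †F^{⊢×μ}_gau` with the poly-isomorphism induced by
the `Θ^{×μ}_{gau}`-link. [cite: Mochizuki2012, Cor 4.10 (iv) p.160] -/
def unitMuGauPolyIso : PolyIso (S.toUnitMu.obj (S.toVdashMu.obj dag.delta))
    (S.toUnitMu.obj (S.toVdashMu.obj ddag.delta)) :=
  polyIsoConj (dag.unitDeltaIsoEnv ≪≫ dag.unitEnvIsoGau)
    (polyIsoMap S.toUnitMu (dag.thetaTimesMuGauLink ddag)) (Iso.refl _)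

/-- STATEMENT (not asserted), Cor 4.10 (iv) p. 160 (**coricity of `F^{⊢×μ}`-prime-strips**): the
poly-isomorphism `†F^{⊢×μ}_△ ⥲ ‡F^{⊢×μ}_△` obtained through EITHER link "coincides with the full
poly-isomorphism between these two `F^{⊢×μ}`-prime-strips — that is to say, `(−)F^{⊢×μ}_△` is an
invariant of both the `Θ^{×μ}`- and `Θ^{×μ}_{gau}`-links". [cite: Mochizuki2012, Cor 4.10 (iv) p.160] -/
def UnitMuCoric : Prop :=
  dag.unitMuPolyIso ddag = PolyIso.full _ _ ∧ dag.unitMuGauPolyIso ddag = PolyIso.full _ _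

/-- The coricity statement holds as soon as the functor `F^{⊩▶×μ} ↦ F^{⊢×μ}` is surjective on the
isomorphisms between the objects concerned (bookkeeping reduction of Cor 4.10 (iv) to a property of
Def 4.9 (vi): passing to isometries/quotients by torsion forgets exactly the value-group data that
distinguishes the two sides). [cite: Mochizuki2012, Cor 4.10 (iv) p.160] -/
theorem unitMuCoric_of_mapIso_surjective
    (h₁ : Function.Surjective
      (S.toUnitMu.mapIso : (S.toVdashMu.obj dag.env ≅ S.toVdashMu.obj ddag.delta) → _))
    (h₂ : Function.Surjective
      (S.toUnitMu.mapIso : (S.toVdashMu.obj dag.gau ≅ S.toVdashMu.obj ddag.delta) → _)) :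
    dag.UnitMuCoric ddag := by
  unfold UnitMuCoric unitMuPolyIso unitMuGauPolyIso
  have hfull₁ : polyIsoMap S.toUnitMu (dag.thetaTimesMuLink ddag) = PolyIso.full _ _ := by
    ext φ
    simp only [polyIsoMap, thetaTimesMuLink, PolyIso.full, Set.mem_univ, true_and,
      Set.mem_setOf_eq, iff_true]
    obtain ⟨ψ, rfl⟩ := h₁ φ
    exact ⟨ψ, rfl⟩
  have hfull₂ : polyIsoMap S.toUnitMu (dag.thetaTimesMuGauLink ddag) = PolyIso.full _ _ := by
    ext φ
    simp only [polyIsoMap, thetaTimesMuGauLink, PolyIso.full, Set.mem_univ, true_and,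
      Set.mem_setOf_eq, iff_true]
    obtain ⟨ψ, rfl⟩ := h₂ φ
    exact ⟨ψ, rfl⟩
  rw [hfull₁, hfull₂, polyIsoConj_full, polyIsoConj_full]
  exact ⟨rfl, rfl⟩

/-- The identifications of Cor 4.10 (i), (ii) transported: `‡F^⊩_△ ≅ ‡F^⊩_mod` and `†F^⊩_env ≅ †F^⊩_tht` let one
read the `Θ^{×μ}`-link as a full poly-isomorphism `†F^{⊩▶×μ}_tht ⥲ ‡F^{⊩▶×μ}_mod` — "[cf. the «Θ-link» of
[IUTchI], Corollary 3.7, (i)]" (p. 160): an "enhanced version" of the [IUTchI] Θ-link.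
[cite: Mochizuki2012, Cor 4.10 (iii) p.160] -/
theorem thetaTimesMuLink_tht_mod :
    polyIsoConj (S.toVdashMu.mapIso dag.envIsoTht.symm) (dag.thetaTimesMuLink ddag)
        (S.toVdashMu.mapIso ddag.deltaIsoMod) = PolyIso.full _ _ := by
  unfold thetaTimesMuLink
  rw [polyIsoConj_full]

/-- The **`D`-`Θ^{±ell}NF`-link** `†HT^{D} ⟶ ‡HT^{D}`: "the full poly-isomorphism `†D^⊢_△ ⥲ ‡D^⊢_△`
between the associated `D^⊢`-prime-strips" ([IUTchII] Cor 4.10 (iv) p. 160).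
[cite: Mochizuki2012, Cor 4.10 (iv) p.160] -/
def dLink : PolyIso (S.toDMono.obj (S.toUnitMu.obj (S.toVdashMu.obj dag.delta)))
    (S.toDMono.obj (S.toUnitMu.obj (S.toVdashMu.obj ddag.delta))) :=
  PolyIso.full _ _

end HodgeTheaterStrips

/-! ### 3. Corollary 4.10 (vi): Frobenius-pictures and the oriented graph `⃗Γ` -/

/-- The data of Cor 4.10 (vi) p. 161: "a collection of distinct `Θ^{±ell}NF`-Hodge theaters indexed
by the integers", giving (via the links of (iii)) the infinite chains
`… ⟶ ⁽ⁿ⁻¹⁾HT ⟶ ⁿHT ⟶ ⁽ⁿ⁺¹⁾HT ⟶ …`. [cite: Mochizuki2012, Cor 4.10 (vi) p.161] -/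
structure ThetaGauChain (S : ThetaLinkSetting FV FVM FUM DM) where
  /-- `ⁿHT^{Θ^{±ell}NF}`, `n ∈ ℤ` (through its strips) -/
  theater : ℤ → HodgeTheaterStrips S
  /-- "distinct" -/
  distinct : Function.Injective theater

/-- The `n`-th `Θ^{×μ}_{gau}`-link of the infinite chain (Cor 4.10 (vi) p. 161).
[cite: Mochizuki2012, Cor 4.10 (vi) p.161] -/
def ThetaGauChain.gauLink {S : ThetaLinkSetting FV FVM FUM DM} (P : ThetaGauChain S) (n : ℤ) :=
  (P.theater n).thetaTimesMuGauLink (P.theater (n + 1))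

/-- The `n`-th `Θ^{×μ}`-link of the infinite chain (Cor 4.10 (vi) p. 161).
[cite: Mochizuki2012, Cor 4.10 (vi) p.161] -/
def ThetaGauChain.timesMuLink {S : ThetaLinkSetting FV FVM FUM DM} (P : ThetaGauChain S) (n : ℤ) :=
  (P.theater n).thetaTimesMuLink (P.theater (n + 1))

/-- Cor 4.10 (vi) p. 161: the oriented graph `⃗Γ` "`… → • → • → • → …`" of either chain "admits a
natural action by `ℤ` — i.e., a translation symmetry": translation by `k` is an automorphism (of the
Frobenius-picture digraph typed by abc-iut-L6-t3, whose spokes `•ₙ` are the vertices of `⃗Γ`).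
[cite: Mochizuki2012, Cor 4.10 (vi) p.161] -/
def cor410vi_translate (k : ℤ) : DigraphAut frobeniusPicture := frobeniusPicture.translate k

/-- The translation by `k` moves the vertex `•ₙ` to `•ₙ₊ₖ`. [cite: Mochizuki2012, Cor 4.10 (vi) p.161] -/
theorem cor410vi_translate_spoke (k n : ℤ) :
    cor410vi_translate k (.spoke n) = .spoke (n + k) := by
  simp [cor410vi_translate]

/-- Cor 4.10 (vi) p. 161: `⃗Γ` "does not admit arbitrary permutation symmetries" — every
automorphism is a translation (derived from abc-iut-L6-t3's `frobeniusPicture.aut_eq_translate`).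
[cite: Mochizuki2012, Cor 4.10 (vi) p.161] -/
theorem cor410vi_aut_eq_translate (σ : DigraphAut frobeniusPicture) :
    ∃ k : ℤ, ∀ a, σ a = cor410vi_translate k a :=
  frobeniusPicture.aut_eq_translate σ

/-- Cor 4.10 (vi) p. 161: "For instance, `⃗Γ` does not admit an automorphism that switches two
adjacent vertices, but leaves the remaining vertices fixed" (derived from abc-iut-L6-t3's
`frobeniusPicture.no_adjacent_swap`). [cite: Mochizuki2012, Cor 4.10 (vi) p.161] -/
theorem cor410vi_no_adjacent_swap (n : ℤ) :
    ¬ ∃ σ : DigraphAut frobeniusPicture,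
      σ (.spoke n) = .spoke (n + 1) ∧ σ (.spoke (n + 1)) = .spoke n :=
  frobeniusPicture.no_adjacent_swap n

/-! ### 4. Corollary 4.11: étale-pictures -/

/-- Cor 4.11 (i) p. 164: the chain of `D`-`Θ^{±ell}NF`-links induces "a chain of full
poly-isomorphisms `… ⥲ ⁿD^⊢_△ ⥲ ⁽ⁿ⁺¹⁾D^⊢_△ ⥲ …`"; `(−)D^⊢_△` "forms a constant invariant … a
mono-analytic core". Recorded: every link of the chain IS the full poly-isomorphism (by definition of
`dLink`), and composites along the chain stay full (`full_comp_full`).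
[cite: Mochizuki2012, Cor 4.11 (i) p.164] -/
theorem ThetaGauChain.dLink_full {S : ThetaLinkSetting FV FVM FUM DM} (P : ThetaGauChain S) (n : ℤ) :
    (P.theater n).dLink (P.theater (n + 1)) = PolyIso.full _ _ := rfl

/-- Cor 4.11 (ii) p. 164 (Fig. 4.3): the étale-picture of `D`-`Θ^{±ell}NF`-Hodge theaters — spokes
`n ∈ ℤ` around the core `(−)D^⊢_△` — "satisfies the important property of admitting arbitrary
permutation symmetries among the spokes": every permutation of `ℤ` extends to an automorphism
(abc-iut-L6-t3's `etalePicture.spokePerm`). [cite: Mochizuki2012, Cor 4.11 (ii) p.164] -/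
def cor411ii_spokePerm (σ : Equiv.Perm ℤ) : etalePicture ℤ ≃g etalePicture ℤ :=
  etalePicture.spokePerm σ

/-- In particular (contrast with `cor410vi_no_adjacent_swap`) the étale-picture admits the
automorphism switching two given spokes and fixing the rest (Cor 4.11 (ii) p. 164; t3's
`etalePicture.exists_swap`). [cite: Mochizuki2012, Cor 4.11 (ii) p.164] -/
theorem cor411ii_exists_swap (i j : ℤ) :
    ∃ τ : etalePicture ℤ ≃g etalePicture ℤ,
      τ (some i) = some j ∧ τ (some j) = some i ∧ ∀ a, a ≠ some i → a ≠ some j → τ a = a :=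
  etalePicture.exists_swap i j

end Links

/-! ### 5. Remarks 4.10.3 (iii), 4.11.1: the theta exponents `(1², 2², …, (l⋇)²)` -/

/-- The exponent `j²` of "`q ↦ q^{(1², …, (l⋇)²)}`" (Remark 4.11.1 p. 164; Remark 3.6.2 (iii)
`q_v ↦ {q_v^{j²}}_{1 ≤ j ≤ l⋇}`), for the label with natural number `j = i + 1`, `i : Fin lstar`.
[cite: Mochizuki2012, Rmk 4.11.1 p.164] -/
def thetaExponent {lstar : ℕ} (i : Fin lstar) : ℕ := (i.val + 1) ^ 2

/-- Remark 4.10.3 (iii) p. 163: restricted to the label `j = 1`, the correspondence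
`q ↦ q^{j²}` "may be naturally identified with the identity": the exponent is `1`.
[cite: Mochizuki2012, Rmk 4.10.3 (iii) p.163] -/
theorem thetaExponent_label_one {lstar : ℕ} (h : 0 < lstar) : thetaExponent (⟨0, h⟩ : Fin lstar) = 1 := by
  simp [thetaExponent]

/-- Remark 3.6.2 (iii) p. 103 / 4.11.1: the top label carries the "Frobenius-like" exponent
`(l⋇)²`. [cite: Mochizuki2012, Rmk 4.11.1 p.164] -/
theorem thetaExponent_label_top {lstar : ℕ} (h : 0 < lstar) :
    thetaExponent (⟨lstar - 1, Nat.sub_lt h Nat.one_pos⟩ : Fin lstar) = lstar ^ 2 := by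
  simp [thetaExponent, Nat.sub_add_cancel h]

/-- Remark 4.11.1 p. 164–165: the Frobenius-picture is "an infinite iteration" of
`q ↦ q^{(j²)_j}`, whereas the étale-picture "corresponds to a sort of commutativity involving these
theta exponents": exponents accumulated along two spokes do not depend on the order.
[cite: Mochizuki2012, Rmk 4.11.1 p.165] -/
theorem thetaExponent_iterate_comm {lstar : ℕ} (i i' : Fin lstar) (q : ℕ) :
    (q ^ thetaExponent i) ^ thetaExponent i' = (q ^ thetaExponent i') ^ thetaExponent i := by
  rw [← pow_mul, ← pow_mul, Nat.mul_comm]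

end Literature.IUT.HodgeArakelov
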